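import Summits.QuantumFields.BalabanUV.Beta.EriceFlowEnclosureB12AsPrintedPointwiseFadingEventualAFEnd
import Literature.MathematicalPhysics.QuantumFieldTheory.Balaban1983to89.T4BetaFlowWellPosed

/-!
# Beta / EriceFlowEnclosureB12AsPrintedPointwiseFadingEventualAFWellPosed — WHAT (0.31) FORCES, part 10g: THE STATIONARY β-FUNCTIONAL OF THE LIMIT THEORY IS POINTWISE ASYMPTOTICALLY FREE
# NEAR ZERO, so node U2's ORIGINAL (floor-based) well-posedness of the flow with memory applies VERBATIM on small boxes.  Node U2's `T4BetaStationary.betaInf β h = lim_k β_{k+1}(h_k, …, h_0)`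
# (the stationary limit functional, existing under NE4) inherits every eventual pointwise floor of β (`le_betaInf_of_eventualLower`); part 10b derived that floor near zero from the TYPED Theorem 2
# + node U2's moduli + NE4.  Hence §1 **`betaInf_lower_of_typedTheorem2`**: ∃ b > 0, δ ∈ ]0, γ_U] with `b ≤ betaInf S.β u` for EVERY box history u ∈ ]0, δ]^ℕ — and the box can be taken with
# node U2's smallness `C_m δ < b(1−θ)` (b is fixed BEFORE δ).  Consequently §2: node U2's `T4BetaFlowWellPosed.existsUnique_memFlow` (Picard from the constant history; floor `hlo` + `hsmall`)
# applies AS IS: **`memFlow_existsUnique_smallBox_of_typedTheorem2`** (∀ g_IR ∈ ]0, δ]: `∃! h, SeqBox δ h ∧ MemFlow (betaInf S.β) g_IR h`), and for Theorem 2's rows in the small box node U2's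
# `eq_gstar_of_memFlow` ∕ `gstar_eq_solution` apply AS IS (**`gstar_rows_eq_solution_of_typedTheorem2`**).  bflow-p1 gens 36–37 (#64f∕g, #65a–e) reach the same ENDs FLOOR-FREE through a
# (0.31)-reference family and their own Picard analysis (valid in any box, deeper); this part records that near zero the floor is simply AVAILABLE, so node U2's §4–§5 need no modification there
# (β-flow team, prover 2 = lower ∕ positivity side, unit `b2b-balaban-beta-bflow-p2`, gen 46; ROW AP-I × node U2's `T4BetaStationary` ∕ `T4BetaFlowWellPosed`; junction only)

HONEST FRAMING (page 1 of everything the β sub-cell writes): discharging `BetaPertH` makes Bałaban's UV stability UNCONDITIONAL — a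
real constructive-QFT result; it is NOT the continuum limit and NOT the Clay problem.  HONEST DEPENDENCY (cell reorg 2026-08-19,
verbatim): «continuum YM on T⁴ ⇐ BetaPertH ∧ nine spine estimates (0/9 proved); BetaPertH ⇐ (D1) ∧ (D4) ∧ CAP+tail; G-an2-4 gates
asym, D1 and NE2/3/4.»  THIS MODULE DISCHARGES NOTHING: bookkeeping BY NAME over node U2's Literature `T4BetaStationary` (`betaInf`, `le_betaInf_of_eventualLower`, `memoryProfile_betaInf`) and
`T4BetaFlowWellPosed` (`existsUnique_memFlow`, `eq_gstar_of_memFlow`, `gstar_eq_solution` — consumed VERBATIM, nothing restated or modified), `T4CouplingMatching.injectedRate_of_runs_eventual`, parts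
10b∕10c, and the NAMED FIELDS of `B12BetaAsPrinted` ([Balaban1987RG1] as typed; `Theorem2Statement` STATED WITHOUT PROOF in print, p. 259 — a HYPOTHESIS) under LETTERS displayed as hypotheses (`hrg`,
`HistLipschitz ∕ FadingMemory ∕ ScaleShiftRate` — NOT printed).  «Flow with memory of the limit theory» = node U2's `MemFlow (betaInf S.β)`, a statement about limits of the effective couplings of
(0.20), NOT about the continuum limit of the measures.  Nothing of Bałaban's objects is asserted.

WHAT THIS FILE PROVES (0 sorry, 0 def): §1 **`betaInf_lower_of_typedTheorem2`** (the floor of the stationary functional near zero, with node U2's smallness); §2 **`memFlow_existsUnique_smallBox_of_typedTheorem2`**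
(node U2's floor-based `∃!` verbatim near zero), **`gstar_rows_eq_solution_of_typedTheorem2`** (Theorem 2's rows in the small box: `gstar = solution (betaInf S.β) g_IR` and every box solution is `gstar`).
NOT CLAIMED: any letter for Bałaban's β; the continuum limit of the measures; which reading print intends; Theorem 2; `BetaPertH`; Clay.
-/

namespace Summit.QuantumFields.BalabanUV.Beta.EriceFlowEnclosureB12AsPrintedPointwiseFadingEventualAFWellPosed

open Literature.MathematicalPhysics.QuantumFieldTheory.Balaban1983to89
open Literature.MathematicalPhysics.QuantumFieldTheory.Balaban1983to89.B12BetaAsPrinted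
open Literature.MathematicalPhysics.QuantumFieldTheory.Balaban1983to89.FlowStep (HBeta prefixOf Box mem_box RGEqH)
open Literature.MathematicalPhysics.QuantumFieldTheory.Balaban1983to89.T4CouplingMatching (HistLipschitz FadingMemory ScaleShiftRate EventualLowerH
  injectedRate_of_runs_eventual disc)
open Literature.MathematicalPhysics.QuantumFieldTheory.Balaban1983to89.T4ContinuumCoupling (gstar)
open Literature.MathematicalPhysics.QuantumFieldTheory.Balaban1983to89.T4BetaStationary (SeqBox betaInf le_betaInf_of_eventualLower memoryProfile_betaInf)
open Literature.MathematicalPhysics.QuantumFieldTheory.Balaban1983to89.T4BetaFlowWellPosed (MemFlow solution existsUnique_memFlow eq_gstar_of_memFlow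
  gstar_eq_solution)
open Summit.QuantumFields.BalabanUV.Beta.EriceFlowEnclosureB12AsPrintedUpper (tunedRuns_of_theorem2Statement)
open Summit.QuantumFields.BalabanUV.Beta.EriceFlowEnclosureB12AsPrintedPointwiseFadingEventualAF (eventualLowerH_of_theorem2_fadingMemory_NE4)
open Summit.QuantumFields.BalabanUV.Beta.EriceFlowEnclosureB12AsPrintedPointwiseFadingEventualAFEnd (histLipschitz_of_le scaleShiftRate_of_le
  eventualLowerH_of_le exists_small_box)

noncomputable section

variable {S : Setting}

/-! ## §1 The stationary β-functional of the limit theory is pointwise asymptotically free near zero -/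

/-- **THE FLOOR OF THE STATIONARY FUNCTIONAL NEAR ZERO, WITH node U2's SMALLNESS.**  `Theorem2Statement S hL` AS TYPED + `hrg` on ]0, γ_U] + `HistLipschitz Λ γ_U S.β` with `FadingMemory C_m θ Λ` +
`ScaleShiftRate c θ γ_U S.β` (0 ≤ θ < 1, 0 ≤ C_m) ⟹ there are b > 0, a threshold index k₀ and, below every cap γ₀ > 0, a box `0 < δ ≤ min(γ_U, γ₀)` with `C_m δ < b(1−θ)` and
`C_m((k₀+1)δ³ + 2δ∕b) ≤ (1−θ)∕2` such that `EventualLowerH b δ k₀ S.β` and **`b ≤ betaInf S.β u` for every `u` with `SeqBox δ u`** (node U2's `le_betaInf_of_eventualLower` on part 10b's letter).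
[cite: Balaban1987RG1, Thm 2 (0.31) p.259 with (0.20) p.256 and §5 p.298] -/
theorem betaInf_lower_of_typedTheorem2 {hL : Odd S.L ∧ 1 < S.L} (hT : Theorem2Statement S hL)
    {γU Cm c θ : ℝ} {Λ : ℕ → ℕ → ℝ} (hγU : 0 < γU) (hθ0 : 0 ≤ θ) (hθ1 : θ < 1) (hCm : 0 ≤ Cm)
    (hrg : ∀ P : B12.RunParams, Step.InInterval γU P.K (S.cpl P) → RGEqH P.K S.β (S.cpl P))
    (hLip : HistLipschitz Λ γU S.β) (hΛ : FadingMemory Cm θ Λ) (hS : ScaleShiftRate c θ γU S.β) :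
    ∃ b : ℝ, 0 < b ∧ ∃ k₀ : ℕ, ∀ γ₀ : ℝ, 0 < γ₀ → ∃ δ : ℝ, 0 < δ ∧ δ ≤ γU ∧ δ ≤ γ₀ ∧ Cm * δ < b * (1 - θ) ∧
      Cm * (((k₀ : ℝ) + 1) * δ ^ 3 + 2 * δ / b) ≤ (1 - θ) / 2 ∧ EventualLowerH b δ k₀ S.β ∧
      ∀ u : ℕ → ℝ, SeqBox δ u → b ≤ betaInf S.β u := by
  obtain ⟨b, hb, δ₁, hδ₁, hδ₁U, k₀, hlo⟩ := eventualLowerH_of_theorem2_fadingMemory_NE4 hT hγU hθ0 hθ1 hCm hrg hLip hΛ hS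
  have h1θ : 0 < 1 - θ := by linarith
  refine ⟨b, hb, k₀, fun γ₀ hγ₀ => ?_⟩
  -- shrink below node U2's smallness and below b(1−θ)/(2(C_m+1))
  have hcap : 0 < min γ₀ (b * (1 - θ) / (2 * (Cm + 1))) := lt_min hγ₀ (by positivity)
  obtain ⟨δ, hδpos, hδδ₁, hδcap, hsmall⟩ := exists_small_box (k₀ := k₀) hb hCm hθ1 hδ₁ hcap
  have hδγ₀ : δ ≤ γ₀ := hδcap.trans (min_le_left _ _)
  have hδb : δ ≤ b * (1 - θ) / (2 * (Cm + 1)) := hδcap.trans (min_le_right _ _)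
  have hCmδ : Cm * δ < b * (1 - θ) := by
    have h2 : 2 * (Cm + 1) * δ ≤ b * (1 - θ) := by rwa [le_div_iff₀ (by positivity), mul_comm] at hδb
    nlinarith [hδpos, hb, h1θ]
  have hloδ : EventualLowerH b δ k₀ S.β := eventualLowerH_of_le hlo hδδ₁
  have hSδ : ScaleShiftRate c θ δ S.β := scaleShiftRate_of_le hS (hδδ₁.trans hδ₁U)
  exact ⟨δ, hδpos, hδδ₁.trans hδ₁U, hδγ₀, hCmδ, hsmall, hloδ, fun u hu => le_betaInf_of_eventualLower hSδ hθ1 hloδ hu⟩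

/-! ## §2 Node U2's floor-based well-posedness, verbatim, on the small box -/

/-- **THE RENORMALIZATION GROUP EQUATION OF THE LIMIT THEORY IS WELL POSED NEAR ZERO — node U2's OWN THEOREM, ITS FLOOR DERIVED.**  Same hypotheses ⟹ ∃ b > 0 and a box `0 < δ ≤ γ_U` such that for EVERY
infrared datum `g_IR ∈ ]0, δ]` node U2's flow with memory of the stationary functional, `MemFlow (betaInf S.β) g_IR h` (`h 0 = g_IR`, `1∕h(m+1)² = 1∕h(m)² + betaInf S.β (h(m+1), h(m+2), …)`), has
EXACTLY ONE box-valued solution: `T4BetaFlowWellPosed.existsUnique_memFlow` applied with `MemoryProfile` from `memoryProfile_betaInf`, the floor from §1 and the smallness `C_m δ < b(1−θ)` from §1.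
(bflow-p1 #64g∕#65b have this END floor-free through a reference family; here node U2's §4 is used unchanged.) [cite: Balaban1987RG1, Thm 2 (0.31) p.259 with (0.20) p.256 and §5 p.298] -/
theorem memFlow_existsUnique_smallBox_of_typedTheorem2 {hL : Odd S.L ∧ 1 < S.L} (hT : Theorem2Statement S hL)
    {γU Cm c θ : ℝ} {Λ : ℕ → ℕ → ℝ} (hγU : 0 < γU) (hθ0 : 0 ≤ θ) (hθ1 : θ < 1) (hCm : 0 ≤ Cm)
    (hrg : ∀ P : B12.RunParams, Step.InInterval γU P.K (S.cpl P) → RGEqH P.K S.β (S.cpl P))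
    (hLip : HistLipschitz Λ γU S.β) (hΛ : FadingMemory Cm θ Λ) (hS : ScaleShiftRate c θ γU S.β) :
    ∃ b : ℝ, 0 < b ∧ ∃ δ : ℝ, 0 < δ ∧ δ ≤ γU ∧ (∀ u : ℕ → ℝ, SeqBox δ u → b ≤ betaInf S.β u) ∧
      ∀ gIR : ℝ, 0 < gIR → gIR ≤ δ → ∃! h : ℕ → ℝ, SeqBox δ h ∧ MemFlow (betaInf S.β) gIR h := by
  obtain ⟨b, hb, k₀, hall⟩ := betaInf_lower_of_typedTheorem2 hT hγU hθ0 hθ1 hCm hrg hLip hΛ hS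
  obtain ⟨δ, hδ, hδU, -, hCmδ, -, -, hfloor⟩ := hall γU hγU
  refine ⟨b, hb, δ, hδ, hδU, hfloor, fun gIR hgIR hle => ?_⟩
  exact existsUnique_memFlow (memoryProfile_betaInf (scaleShiftRate_of_le hS hδU) (histLipschitz_of_le hLip hδU) hΛ hθ0 hθ1)
    hCm hθ0 hθ1 hgIR hle hb hfloor hCmδ

/-- **THEOREM 2's ROWS IN THE SMALL BOX: the continuum running coupling IS node U2's Picard solution, and every box solution is it** — node U2's `gstar_eq_solution` and `eq_gstar_of_memFlow`
VERBATIM (their `InjectedRate` input from `injectedRate_of_runs_eventual`, their floor `EventualLowerH b` and smallness `C_m γ < b(1−θ)` from §1).  For every torus exponent m there is g₃ > 0 such that for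
every `g_IR ∈ ]0, g₃]` Theorem 2's tuned rows «g₀(ε, g_IR)» (pinned at g_IR, in the small box) satisfy `gstar rows = solution (betaInf S.β) g_IR` and
`∀ h, SeqBox δ h → MemFlow (betaInf S.β) g_IR h → h = gstar rows`. [cite: Balaban1987RG1, Thm 2 (0.31) p.259 with (0.20) p.256 and §5 p.298] -/
theorem gstar_rows_eq_solution_of_typedTheorem2 {hL : Odd S.L ∧ 1 < S.L} (hT : Theorem2Statement S hL)
    {γU Cm c θ : ℝ} {Λ : ℕ → ℕ → ℝ} (hγU : 0 < γU) (hθ0 : 0 < θ) (hθ1 : θ < 1) (hCm : 0 ≤ Cm) (hc : 0 ≤ c)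
    (hrg : ∀ P : B12.RunParams, Step.InInterval γU P.K (S.cpl P) → RGEqH P.K S.β (S.cpl P))
    (hLip : HistLipschitz Λ γU S.β) (hΛ : FadingMemory Cm θ Λ) (hS : ScaleShiftRate c θ γU S.β) :
    ∃ b : ℝ, 0 < b ∧ ∀ m : ℕ, ∃ δ g₃ : ℝ, 0 < δ ∧ δ ≤ γU ∧ 0 < g₃ ∧ g₃ ≤ δ ∧ ∀ gIR : ℝ, 0 < gIR → gIR ≤ g₃ →
      ∃ g₀ : ℕ → ℝ, (∀ K, Step.InInterval δ K (S.cpl ⟨K, m, g₀ K⟩)) ∧ (∀ K, S.cpl ⟨K, m, g₀ K⟩ K = gIR) ∧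
        gstar (fun K => S.cpl ⟨K, m, g₀ K⟩) = solution (betaInf S.β) gIR ∧
        ∀ h : ℕ → ℝ, SeqBox δ h → MemFlow (betaInf S.β) gIR h → h = gstar (fun K => S.cpl ⟨K, m, g₀ K⟩) := by
  obtain ⟨b, hb, k₀, hall⟩ := betaInf_lower_of_typedTheorem2 hT hγU hθ0.le hθ1 hCm hrg hLip hΛ hS
  refine ⟨b, hb, fun m => ?_⟩
  obtain ⟨γ₀, hγ₀, hγ⟩ := tunedRuns_of_theorem2Statement hT m
  obtain ⟨δ, hδ, hδU, hδγ₀, hCmδ, hsmall, hloδ, -⟩ := hall γ₀ hγ₀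
  obtain ⟨g₁, hg₁, hg⟩ := hγ δ hδ hδγ₀
  have hSδ : ScaleShiftRate c θ δ S.β := scaleShiftRate_of_le hS hδU
  have hLδ : HistLipschitz Λ δ S.β := histLipschitz_of_le hLip hδU
  refine ⟨δ, min g₁ δ, hδ, hδU, lt_min hg₁ hδ, min_le_right _ _, fun gIR hgIR hle => ?_⟩
  obtain ⟨β, β', -, -, hK⟩ := hg gIR hgIR (hle.trans (min_le_left _ _))
  choose g₀ hI hend _h031 using hK
  have hbox : ∀ K i, i ≤ K → 0 < S.cpl ⟨K, m, g₀ K⟩ i ∧ S.cpl ⟨K, m, g₀ K⟩ i ≤ δ := fun K i hi => hI K i hi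
  have hrun : ∀ K, RGEqH K S.β (S.cpl ⟨K, m, g₀ K⟩) := fun K =>
    hrg ⟨K, m, g₀ K⟩ fun i hi => ⟨(hI K i hi).1, (hI K i hi).2.trans hδU⟩
  have hinj := injectedRate_of_runs_eventual (fun K => S.cpl ⟨K, m, g₀ K⟩) gIR hδ hb hθ0 hθ1 hc hCm hrun hbox hend hSδ hLδ hΛ hloδ hsmall
  refine ⟨g₀, hI, hend, gstar_eq_solution hθ1 hinj hbox hrun hend hSδ hLδ hΛ hθ0.le hθ1 hloδ hb hCmδ, fun h hh hf => ?_⟩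
  exact eq_gstar_of_memFlow hθ1 hinj hbox hrun hend hSδ hLδ hΛ hθ0.le hθ1 hloδ hb hCmδ hh hf

end

end Summit.QuantumFields.BalabanUV.Beta.EriceFlowEnclosureB12AsPrintedPointwiseFadingEventualAFWellPosed
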